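import Mathlib
import Literature.Probability.Moments.DecorrelationExtension
import HarnessLib

/-!
# Ventures/FusionMHD — Models/CerfonFreidbergIterLikeQHalfShearEnvelope.lean: the TUBE ENVELOPE of the `q′`-kernel
# `K = X_a/(R²D²) − s·F2/(R·D³)` — pure algebra (no instance object)

HONEST FRAMING (LADDER-GRIDFUSION three columns; CF rung, F2 item R2; «F2.R2-CF-SHEAR-ITER» step (4) of `pub/gridfusion/models/F2-SCOPING.md`
v1.6 §10(c), infrastructure, LOW, no count).  Elementary real inequalities: reciprocal differences `|1/a − 1/b|`, `|1/a² − 1/b²|`, `|1/a³ − 1/b³|`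
under two-sided bounds, the product rule for differences (`Literature.Probability.Moments.abs_mul_sub_mul_le`, reused), and **`shear_envelope`**: with `|s − m| ≤ r`, `|R_s − R_m| ≤ r`, `|D_s − D_m| ≤ Mr`,
`|F_s − F_m| ≤ M₃r`, `μ ≤ D ≤ ν`, `X⁻ ≤ R ≤ X⁺`, `0 ≤ s, m ≤ s_max`, `|F| ≤ M`, `X_a ≤ X`:
`|K_s − K_m| ≤ envE X r M M₃ μ ν X⁻ X⁺ s_max` where `envE` is ONE explicit rational function (stated over any field so that the per-panel
rational check `…QHalfShearLink.ShearLink.check` and the real lemma share it).  [folklore] throughout; nothing modelled, nothing cited beyond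
calculus.  Typer/prover: gridfusion-model-7 (g7), 2026-08-27.
-/

noncomputable section

set_option autoImplicit false

namespace Summit.Ventures.FusionMHD.Models.CFIterLike.QHalf

/-! ## §1 The tube envelope of the shear kernel (pure algebra) -/

/-- `|1/a − 1/b| ≤ δ/lo²` for `a, b ≥ lo > 0`, `|a − b| ≤ δ`. [folklore] -/
theorem inv_sub_inv_abs_le {a b lo δ : ℝ} (hlo : 0 < lo) (ha : lo ≤ a) (hb : lo ≤ b) (hab : |a - b| ≤ δ) :
    |1 / a - 1 / b| ≤ δ / lo ^ 2 := by
  have ha0 : 0 < a := hlo.trans_le ha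
  have hb0 : 0 < b := hlo.trans_le hb
  have hδ : 0 ≤ δ := (abs_nonneg _).trans hab
  rw [div_sub_div _ _ ha0.ne' hb0.ne', abs_div, one_mul, mul_one, abs_of_pos (mul_pos ha0 hb0), abs_sub_comm]
  rw [div_le_div_iff₀ (mul_pos ha0 hb0) (by positivity)]
  calc |a - b| * lo ^ 2 ≤ δ * lo ^ 2 := mul_le_mul_of_nonneg_right hab (by positivity)
    _ ≤ δ * (a * b) := by
        apply mul_le_mul_of_nonneg_left _ hδ
        rw [sq]; exact mul_le_mul ha hb hlo.le ha0.le

/-- `|1/a² − 1/b²| ≤ 2δ·hi/lo⁴` for `lo ≤ a, b ≤ hi`, `lo > 0`, `|a − b| ≤ δ`. [folklore] -/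
theorem inv_sq_sub_abs_le {a b lo hi δ : ℝ} (hlo : 0 < lo) (ha : lo ≤ a) (hb : lo ≤ b) (ha' : a ≤ hi) (hb' : b ≤ hi)
    (hab : |a - b| ≤ δ) : |1 / a ^ 2 - 1 / b ^ 2| ≤ 2 * δ * hi / lo ^ 4 := by
  have ha0 : 0 < a := hlo.trans_le ha
  have hb0 : 0 < b := hlo.trans_le hb
  have hδ : 0 ≤ δ := (abs_nonneg _).trans hab
  have hhi : 0 ≤ hi := ha0.le.trans ha'
  have e : 1 / a ^ 2 - 1 / b ^ 2 = (b - a) * (b + a) / (a ^ 2 * b ^ 2) := by field_simp; ring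
  rw [e, abs_div, abs_mul, abs_of_pos (by positivity : 0 < a ^ 2 * b ^ 2), abs_of_pos (by positivity : 0 < b + a), abs_sub_comm]
  rw [div_le_div_iff₀ (by positivity) (by positivity)]
  have h1 : |a - b| * (b + a) ≤ δ * (2 * hi) := mul_le_mul hab (by linarith) (by positivity) hδ
  have h2 : lo ^ 4 ≤ a ^ 2 * b ^ 2 := by
    rw [show lo ^ 4 = lo ^ 2 * lo ^ 2 by ring]
    exact mul_le_mul (pow_le_pow_left₀ hlo.le ha 2) (pow_le_pow_left₀ hlo.le hb 2) (by positivity) (by positivity)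
  calc |a - b| * (b + a) * lo ^ 4 ≤ δ * (2 * hi) * lo ^ 4 := mul_le_mul_of_nonneg_right h1 (by positivity)
    _ ≤ δ * (2 * hi) * (a ^ 2 * b ^ 2) := mul_le_mul_of_nonneg_left h2 (by positivity)
    _ = 2 * δ * hi * (a ^ 2 * b ^ 2) := by ring

/-- `|1/a³ − 1/b³| ≤ 3δ·hi²/lo⁶`. [folklore] -/
theorem inv_cube_sub_abs_le {a b lo hi δ : ℝ} (hlo : 0 < lo) (ha : lo ≤ a) (hb : lo ≤ b) (ha' : a ≤ hi) (hb' : b ≤ hi)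
    (hab : |a - b| ≤ δ) : |1 / a ^ 3 - 1 / b ^ 3| ≤ 3 * δ * hi ^ 2 / lo ^ 6 := by
  have ha0 : 0 < a := hlo.trans_le ha
  have hb0 : 0 < b := hlo.trans_le hb
  have hδ : 0 ≤ δ := (abs_nonneg _).trans hab
  have hhi : 0 ≤ hi := ha0.le.trans ha'
  have e : 1 / a ^ 3 - 1 / b ^ 3 = (b - a) * (b ^ 2 + b * a + a ^ 2) / (a ^ 3 * b ^ 3) := by field_simp; ring
  have hq : 0 < b ^ 2 + b * a + a ^ 2 := by positivity
  rw [e, abs_div, abs_mul, abs_of_pos (by positivity : 0 < a ^ 3 * b ^ 3), abs_of_pos hq, abs_sub_comm]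
  rw [div_le_div_iff₀ (by positivity) (by positivity)]
  have hq' : b ^ 2 + b * a + a ^ 2 ≤ 3 * hi ^ 2 := by
    nlinarith [mul_le_mul ha' ha' ha0.le hhi, mul_le_mul hb' hb' hb0.le hhi, mul_le_mul hb' ha' ha0.le hhi]
  have h1 : |a - b| * (b ^ 2 + b * a + a ^ 2) ≤ δ * (3 * hi ^ 2) := mul_le_mul hab hq' hq.le hδ
  have h2 : lo ^ 6 ≤ a ^ 3 * b ^ 3 := by
    rw [show lo ^ 6 = lo ^ 3 * lo ^ 3 by ring]
    exact mul_le_mul (pow_le_pow_left₀ hlo.le ha 3) (pow_le_pow_left₀ hlo.le hb 3) (by positivity) (by positivity)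
  calc |a - b| * (b ^ 2 + b * a + a ^ 2) * lo ^ 6 ≤ δ * (3 * hi ^ 2) * lo ^ 6 := mul_le_mul_of_nonneg_right h1 (by positivity)
    _ ≤ δ * (3 * hi ^ 2) * (a ^ 3 * b ^ 3) := mul_le_mul_of_nonneg_left h2 (by positivity)
    _ = 3 * δ * hi ^ 2 * (a ^ 3 * b ^ 3) := by ring

/-- **The envelope bound as a formula** (generic field, so that the rational check and the real lemma share it):
`X·(2rX⁺/X⁻⁴/μ² + 2Mrν/μ⁴/X⁻²) + rM/(X⁻μ³) + s_max M₃ r/(X⁻μ³) + s_max M (r/X⁻²/μ³ + 3Mrν²/μ⁶/X⁻)`. -/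
def envE {K : Type*} [Field K] (X r M M3 μ ν Xlo Xhi smax : K) : K :=
  X * (2 * r * Xhi / Xlo ^ 4 / μ ^ 2 + 2 * (M * r) * ν / μ ^ 4 / Xlo ^ 2)
    + (r * M / (Xlo * μ ^ 3) + smax * (M3 * r) / (Xlo * μ ^ 3) + smax * M * (r / Xlo ^ 2 / μ ^ 3 + 3 * (M * r) * ν ^ 2 / μ ^ 6 / Xlo))

/-- The rational formula casts to the real one. -/
theorem envE_cast (X r M M3 μ ν Xlo Xhi smax : ℚ) :
    ((envE X r M M3 μ ν Xlo Xhi smax : ℚ) : ℝ) = envE (X : ℝ) (r : ℝ) (M : ℝ) (M3 : ℝ) (μ : ℝ) (ν : ℝ) (Xlo : ℝ) (Xhi : ℝ) (smax : ℝ) := by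
  unfold envE; push_cast; ring

/-- **THE SHEAR-KERNEL TUBE ENVELOPE (pure algebra).**  With `K(x, R, D, F) = X_a/(R²D²) − x·F/(R·D³)`: if `|s − m| ≤ r`, `|R_s − R_m| ≤ r`,
`|D_s − D_m| ≤ Mr`, `|F_s − F_m| ≤ M₃r`, `μ ≤ D ≤ ν`, `X⁻ ≤ R ≤ X⁺`, `0 ≤ s, m ≤ s_max`, `|F| ≤ M` at both points and `X_a ≤ X`, then
`|K_s − K_m| ≤ envE X r M M₃ μ ν X⁻ X⁺ s_max`. [folklore] -/
theorem shear_envelope {Xa XB s m Rs Rm Ds Dm Fs Fm r M M3 μ ν Xlo Xhi smax : ℝ}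
    (hXa : 0 < Xa) (hXB : Xa ≤ XB) (hμ : 0 < μ) (hXlo : 0 < Xlo) (hr : 0 ≤ r) (hM : 0 ≤ M) (hM3 : 0 ≤ M3)
    (hsm : |s - m| ≤ r) (hR : |Rs - Rm| ≤ r) (hD : |Ds - Dm| ≤ M * r) (hF : |Fs - Fm| ≤ M3 * r)
    (hDs : μ ≤ Ds ∧ Ds ≤ ν) (hDm : μ ≤ Dm ∧ Dm ≤ ν) (hRs : Xlo ≤ Rs ∧ Rs ≤ Xhi) (hRm : Xlo ≤ Rm ∧ Rm ≤ Xhi)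
    (hs : 0 ≤ s ∧ s ≤ smax) (hm : 0 ≤ m ∧ m ≤ smax) (hFs : |Fs| ≤ M) (hFm : |Fm| ≤ M) :
    |(Xa / (Rs ^ 2 * Ds ^ 2) - s * Fs / (Rs * Ds ^ 3)) - (Xa / (Rm ^ 2 * Dm ^ 2) - m * Fm / (Rm * Dm ^ 3))|
      ≤ envE XB r M M3 μ ν Xlo Xhi smax := by
  have hDs0 : 0 < Ds := hμ.trans_le hDs.1
  have hDm0 : 0 < Dm := hμ.trans_le hDm.1
  have hRs0 : 0 < Rs := hXlo.trans_le hRs.1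
  have hRm0 : 0 < Rm := hXlo.trans_le hRm.1
  have hsmax : 0 ≤ smax := hs.1.trans hs.2
  have hXhi : 0 < Xhi := hRs0.trans_le hRs.2
  have hν : 0 < ν := hDs0.trans_le hDs.2
  -- reciprocal differences
  have iR1 : |1 / Rs - 1 / Rm| ≤ r / Xlo ^ 2 := inv_sub_inv_abs_le hXlo hRs.1 hRm.1 hR
  have iR2 : |1 / Rs ^ 2 - 1 / Rm ^ 2| ≤ 2 * r * Xhi / Xlo ^ 4 := inv_sq_sub_abs_le hXlo hRs.1 hRm.1 hRs.2 hRm.2 hR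
  have iD2 : |1 / Ds ^ 2 - 1 / Dm ^ 2| ≤ 2 * (M * r) * ν / μ ^ 4 := inv_sq_sub_abs_le hμ hDs.1 hDm.1 hDs.2 hDm.2 hD
  have iD3 : |1 / Ds ^ 3 - 1 / Dm ^ 3| ≤ 3 * (M * r) * ν ^ 2 / μ ^ 6 := inv_cube_sub_abs_le hμ hDs.1 hDm.1 hDs.2 hDm.2 hD
  -- reciprocal bounds
  have bRm2 : |1 / Rm ^ 2| ≤ 1 / Xlo ^ 2 := by
    rw [abs_of_pos (by positivity)]; exact one_div_le_one_div_of_le (by positivity) (pow_le_pow_left₀ hXlo.le hRm.1 2)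
  have bDs2 : |1 / Ds ^ 2| ≤ 1 / μ ^ 2 := by
    rw [abs_of_pos (by positivity)]; exact one_div_le_one_div_of_le (by positivity) (pow_le_pow_left₀ hμ.le hDs.1 2)
  have bDs3 : |1 / Ds ^ 3| ≤ 1 / μ ^ 3 := by
    rw [abs_of_pos (by positivity)]; exact one_div_le_one_div_of_le (by positivity) (pow_le_pow_left₀ hμ.le hDs.1 3)
  have bRm1 : |1 / Rm| ≤ 1 / Xlo := by
    rw [abs_of_pos (by positivity)]; exact one_div_le_one_div_of_le hXlo hRm.1
  have bRs1 : |1 / Rs| ≤ 1 / Xlo := by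
    rw [abs_of_pos (by positivity)]; exact one_div_le_one_div_of_le hXlo hRs.1
  -- A part
  have hA : |Xa / (Rs ^ 2 * Ds ^ 2) - Xa / (Rm ^ 2 * Dm ^ 2)| ≤ XB * (2 * r * Xhi / Xlo ^ 4 / μ ^ 2 + 2 * (M * r) * ν / μ ^ 4 / Xlo ^ 2) := by
    have e : Xa / (Rs ^ 2 * Ds ^ 2) - Xa / (Rm ^ 2 * Dm ^ 2) = Xa * ((1 / Rs ^ 2) * (1 / Ds ^ 2) - (1 / Rm ^ 2) * (1 / Dm ^ 2)) := by
      field_simp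
    rw [e, abs_mul, abs_of_pos hXa]
    have h := Literature.Probability.Moments.abs_mul_sub_mul_le (1 / Rs ^ 2) (1 / Ds ^ 2) (1 / Rm ^ 2) (1 / Dm ^ 2)
    have t1 : |1 / Rs ^ 2 - 1 / Rm ^ 2| * |1 / Ds ^ 2| ≤ (2 * r * Xhi / Xlo ^ 4) * (1 / μ ^ 2) :=
      mul_le_mul iR2 bDs2 (abs_nonneg _) (by positivity)
    have t2 : |1 / Rm ^ 2| * |1 / Ds ^ 2 - 1 / Dm ^ 2| ≤ (1 / Xlo ^ 2) * (2 * (M * r) * ν / μ ^ 4) :=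
      mul_le_mul bRm2 iD2 (abs_nonneg _) (by positivity)
    have hin : |(1 / Rs ^ 2) * (1 / Ds ^ 2) - (1 / Rm ^ 2) * (1 / Dm ^ 2)| ≤ 2 * r * Xhi / Xlo ^ 4 / μ ^ 2 + 2 * (M * r) * ν / μ ^ 4 / Xlo ^ 2 :=
      calc _ ≤ _ := h
        _ ≤ (2 * r * Xhi / Xlo ^ 4) * (1 / μ ^ 2) + (1 / Xlo ^ 2) * (2 * (M * r) * ν / μ ^ 4) := add_le_add t1 t2
        _ = _ := by ring
    exact mul_le_mul hXB hin (abs_nonneg _) (hXa.le.trans hXB)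
  -- B part
  have hB : |s * Fs / (Rs * Ds ^ 3) - m * Fm / (Rm * Dm ^ 3)| ≤ r * M / (Xlo * μ ^ 3) + smax * (M3 * r) / (Xlo * μ ^ 3)
      + smax * M * (r / Xlo ^ 2 / μ ^ 3 + 3 * (M * r) * ν ^ 2 / μ ^ 6 / Xlo) := by
    have e : s * Fs / (Rs * Ds ^ 3) - m * Fm / (Rm * Dm ^ 3)
        = (s * Fs) * ((1 / Rs) * (1 / Ds ^ 3)) - (m * Fm) * ((1 / Rm) * (1 / Dm ^ 3)) := by field_simp
    rw [e]
    have h := Literature.Probability.Moments.abs_mul_sub_mul_le (s * Fs) ((1 / Rs) * (1 / Ds ^ 3)) (m * Fm) ((1 / Rm) * (1 / Dm ^ 3))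
    have hw : |(1 / Rs) * (1 / Ds ^ 3) - (1 / Rm) * (1 / Dm ^ 3)| ≤ r / Xlo ^ 2 / μ ^ 3 + 3 * (M * r) * ν ^ 2 / μ ^ 6 / Xlo := by
      have h2 := Literature.Probability.Moments.abs_mul_sub_mul_le (1 / Rs) (1 / Ds ^ 3) (1 / Rm) (1 / Dm ^ 3)
      have t1 : |1 / Rs - 1 / Rm| * |1 / Ds ^ 3| ≤ (r / Xlo ^ 2) * (1 / μ ^ 3) := mul_le_mul iR1 bDs3 (abs_nonneg _) (by positivity)
      have t2 : |1 / Rm| * |1 / Ds ^ 3 - 1 / Dm ^ 3| ≤ (1 / Xlo) * (3 * (M * r) * ν ^ 2 / μ ^ 6) :=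
        mul_le_mul bRm1 iD3 (abs_nonneg _) (by positivity)
      calc _ ≤ _ := h2
        _ ≤ (r / Xlo ^ 2) * (1 / μ ^ 3) + (1 / Xlo) * (3 * (M * r) * ν ^ 2 / μ ^ 6) := add_le_add t1 t2
        _ = _ := by ring
    have hw1 : |(1 / Rs) * (1 / Ds ^ 3)| ≤ 1 / Xlo * (1 / μ ^ 3) := by
      rw [abs_mul]; exact mul_le_mul bRs1 bDs3 (abs_nonneg _) (by positivity)
    have huv : |s * Fs - m * Fm| ≤ r * M + smax * (M3 * r) := by
      have h3 := Literature.Probability.Moments.abs_mul_sub_mul_le s Fs m Fm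
      have t1 : |s - m| * |Fs| ≤ r * M := mul_le_mul hsm hFs (abs_nonneg _) hr
      have t2 : |m| * |Fs - Fm| ≤ smax * (M3 * r) := by
        rw [abs_of_nonneg hm.1]; exact mul_le_mul hm.2 hF (abs_nonneg _) hsmax
      linarith
    have hu2 : |m * Fm| ≤ smax * M := by
      rw [abs_mul, abs_of_nonneg hm.1]; exact mul_le_mul hm.2 hFm (abs_nonneg _) hsmax
    have t1 : |s * Fs - m * Fm| * |(1 / Rs) * (1 / Ds ^ 3)| ≤ (r * M + smax * (M3 * r)) * (1 / Xlo * (1 / μ ^ 3)) :=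
      mul_le_mul huv hw1 (abs_nonneg _) (by positivity)
    have t2 : |m * Fm| * |(1 / Rs) * (1 / Ds ^ 3) - (1 / Rm) * (1 / Dm ^ 3)|
        ≤ (smax * M) * (r / Xlo ^ 2 / μ ^ 3 + 3 * (M * r) * ν ^ 2 / μ ^ 6 / Xlo) :=
      mul_le_mul hu2 hw (abs_nonneg _) (by positivity)
    calc _ ≤ _ := h
      _ ≤ (r * M + smax * (M3 * r)) * (1 / Xlo * (1 / μ ^ 3))
          + (smax * M) * (r / Xlo ^ 2 / μ ^ 3 + 3 * (M * r) * ν ^ 2 / μ ^ 6 / Xlo) := add_le_add t1 t2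
      _ = _ := by ring
  -- combine
  rw [show (Xa / (Rs ^ 2 * Ds ^ 2) - s * Fs / (Rs * Ds ^ 3)) - (Xa / (Rm ^ 2 * Dm ^ 2) - m * Fm / (Rm * Dm ^ 3))
      = (Xa / (Rs ^ 2 * Ds ^ 2) - Xa / (Rm ^ 2 * Dm ^ 2)) - (s * Fs / (Rs * Ds ^ 3) - m * Fm / (Rm * Dm ^ 3)) by ring]
  unfold envE
  exact (abs_sub _ _).trans (add_le_add hA hB)

end Summit.Ventures.FusionMHD.Models.CFIterLike.QHalf

end
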